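import Summits.NavierStokesRegularity.NavierStokesRegularity.Theses.PlaneEnergyCeiling
import Literature.Analysis.FluidPDE.BlowupAncientSolutionProofs
import Literature.Analysis.FluidPDE.KNSSLiouvilleBridge

/-!
# `PlanarEnergyLiouville` (stmt-NavierStokesRegularity-16856): which clauses are load-bearing — planar bound (constants), smoothness (as typed, null-set spike); measurability is redundant

Negative (support) lemmas for the crux `PlaneEnergyCeiling.PlanarEnergyLiouville` (route
`PlaneEnergyCeiling`, rank 3), extracted from the crux-attack work file
`Cruxes/PlanarEnergyLiouville/Disproof.lean` (refuter crux-attack seat, 2026-08-17).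

The crux reads: a bounded ancient mild solution `v` of NS (`ν = 1`, KNSS duality class
`IsBoundedAncientMildSolution 1 v`) with (2) measurable slices, (3) jointly `C^∞` on `(−∞,0) × ℝ³`,
and (4) planar kinetic energies `∫_{R({x₂=c})} |v(t)|² dA` bounded uniformly in `t, R, c`, vanishes
identically on `t < 0`.

* `aestronglyMeasurable_slice_of_contDiffOn` — clause (2) FOLLOWS from clause (3): a field jointly
  smooth on the open slab has continuous, hence (a.e. strongly) measurable, slices at every `t < 0`.
  So clause (2) is decoration (kept in the crux only to match the output of `PlanarEnergyZoomA` and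
  the input of the vendored `LiouvilleConjectureNS`).
* `lintegral_enorm_sq_const_eq_top` — the planar energy of a nonzero constant is `⊤` on every plane
  (Lebesgue measure of `ℝ²` is infinite); `planarBound_const_iff` — a constant-in-space field
  `(t, x) ↦ b t` satisfies clause (4) iff `b t = 0` for all `t < 0`: clause (4) excludes EXACTLY the
  KNSS constants and parasitic drifts `b(t)` (the known bounded ancient mild solutions, in tree:
  `isBoundedAncientMildSolution_fun_const`, `AncientMildDrift`) and asks nothing more of them.
* `planarEnergyLiouville_false_without_planarBound` — WITHOUT clause (4) the crux is FALSE: the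
  constant field `e₀` is a bounded ancient mild solution, measurable, jointly smooth and nonzero.
* `planarEnergyLiouville_false_without_smoothness` — WITHOUT clause (3) the crux is FALSE AS TYPED:
  the null-set spike (`e₀` at the origin, `0` elsewhere) is slice-wise a.e. zero, hence in the
  duality class (`IsBoundedAncientMildSolution.congr_ae_slice`), measurable, with all planar
  energies `0`, and not pointwise zero. Clause (3) is what licenses the POINTWISE conclusion; the
  smoothness-free variant with conclusion `v t =ᵐ 0` is not touched (KNSS: bounded mild ancient
  solutions have a representative smooth in `x`, so that variant is the morally equivalent open
  statement).

Consequence for provers: any proof of the crux must use the planar bound in a way that sees the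
far field (it is the only clause distinguishing `v` from a constant) and the continuity of slices
to pass from a.e. to pointwise; the measurability clause may be discarded at once. [folklore]
-/

noncomputable section

namespace Summit.NavierStokesRegularity.NavierStokesRegularity.Theorems.PlanarEnergyLiouvilleNegative

open Set Filter Topology MeasureTheory Function
open scoped ENNReal
open Literature.Analysis.FluidPDE

/-! ## Clause (2) follows from clause (3) -/

/-- **Slices of a jointly smooth field are continuous**: if `uncurry v` is `C^∞` (indeed `C⁰`
suffices) on `(−∞,0) × ℝ³`, then `v t` is continuous for every `t < 0`. [folklore] -/
theorem continuous_slice_of_contDiffOn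
    {v : ℝ → EuclideanSpace ℝ (Fin 3) → EuclideanSpace ℝ (Fin 3)}
    (hsm : ContDiffOn ℝ (⊤ : ℕ∞) (Function.uncurry v) (Set.Iio 0 ×ˢ Set.univ)) {t : ℝ} (ht : t < 0) :
    Continuous (v t) := by
  have hc : ContinuousOn (Function.uncurry v) (Set.Iio 0 ×ˢ Set.univ) := hsm.continuousOn
  have h2 : Continuous fun x : EuclideanSpace ℝ (Fin 3) => Function.uncurry v (t, x) :=
    hc.comp_continuous (by fun_prop) (fun x => ⟨ht, Set.mem_univ _⟩)
  simpa [Function.uncurry] using h2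

/-- **The measurability clause of the crux is redundant**: clause (3) (joint smoothness on the
open slab) implies clause (2) (a.e. strongly measurable slices at every `t < 0`). [folklore] -/
theorem aestronglyMeasurable_slice_of_contDiffOn
    {v : ℝ → EuclideanSpace ℝ (Fin 3) → EuclideanSpace ℝ (Fin 3)}
    (hsm : ContDiffOn ℝ (⊤ : ℕ∞) (Function.uncurry v) (Set.Iio 0 ×ˢ Set.univ)) :
    ∀ t < 0, AEStronglyMeasurable (v t) (volume : Measure (EuclideanSpace ℝ (Fin 3))) :=
  fun _ ht => (continuous_slice_of_contDiffOn hsm ht).aestronglyMeasurable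

/-! ## Clause (4) on constants: tightness and load-bearing -/

/-- **Planar energy of a nonzero constant is infinite**: `∫⁻ _ : ℝ², ‖b‖ₑ² = ⊤` for `b ≠ 0`
(the Lebesgue measure of the plane is infinite). [folklore] -/
theorem lintegral_enorm_sq_const_eq_top {b : EuclideanSpace ℝ (Fin 3)} (hb : b ≠ 0) :
    ∫⁻ _ : EuclideanSpace ℝ (Fin 2), ‖b‖ₑ ^ 2 = ⊤ := by
  have hne : ‖b‖ₑ ^ 2 ≠ 0 := pow_ne_zero _ (by rwa [enorm_ne_zero])
  simp only [lintegral_const, measure_univ_of_isAddLeftInvariant]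
  exact ENNReal.mul_top hne

/-- **Tightness of the planar clause on constants.** The constant-in-space field `(t, x) ↦ b t`
satisfies the planar-bound clause of the crux (verbatim) iff `b t = 0` for every `t < 0`: the clause
excludes exactly the KNSS constants / parasitic drifts and nothing less. [folklore] -/
theorem planarBound_const_iff (b : ℝ → EuclideanSpace ℝ (Fin 3)) :
    (∃ M : ℝ, ∀ t < 0, ∀ (R : EuclideanSpace ℝ (Fin 3) ≃ₗᵢ[ℝ] EuclideanSpace ℝ (Fin 3)) (c : ℝ),
        ∫⁻ y : EuclideanSpace ℝ (Fin 2),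
          ‖(fun (t : ℝ) (_ : EuclideanSpace ℝ (Fin 3)) => b t) t (R (WithLp.toLp 2 ![y 0, y 1, c]))‖ₑ ^ 2
            ≤ ENNReal.ofReal M) ↔
      ∀ t < 0, b t = 0 := by
  constructor
  · rintro ⟨M, hM⟩ t ht
    by_contra hb
    have hle := hM t ht (LinearIsometryEquiv.refl ℝ (EuclideanSpace ℝ (Fin 3))) 0
    beta_reduce at hle
    rw [lintegral_enorm_sq_const_eq_top hb] at hle
    exact ENNReal.ofReal_ne_top (top_le_iff.1 hle)
  · intro h
    refine ⟨0, fun t ht R c => ?_⟩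
    simp [h t ht]

/-- **LOAD-BEARING (the planar bound).** `PlaneEnergyCeiling.PlanarEnergyLiouville` with its
planar-bound clause DROPPED (everything else verbatim) is FALSE: the constant field
`e₀ = EuclideanSpace.single 0 1` is a bounded ancient mild solution for `ν = 1`
(`isBoundedAncientMildSolution_fun_const`, KNSS 2009 §1), has measurable slices, is jointly smooth,
and does not vanish at `t = -1`. Hence every proof of the crux must use the planar bound. [cite: KochNadirashviliSereginSverak2009, §1 (constants and the parasitic solutions b(t) are bounded ancient mild solutions)] -/
theorem planarEnergyLiouville_false_without_planarBound :
    ¬ (∀ (v : ℝ → EuclideanSpace ℝ (Fin 3) → EuclideanSpace ℝ (Fin 3)),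
        Literature.Analysis.FluidPDE.IsBoundedAncientMildSolution 1 v →
        (∀ t < 0, MeasureTheory.AEStronglyMeasurable (v t) MeasureTheory.volume) →
        ContDiffOn ℝ (⊤ : ℕ∞) (Function.uncurry v) (Set.Iio 0 ×ˢ Set.univ) →
        ∀ t < 0, ∀ x, v t x = 0) := by
  intro h
  have h1 := h (fun _ _ => EuclideanSpace.single 0 1) (isBoundedAncientMildSolution_fun_const 1 _)
    (fun t _ => aestronglyMeasurable_const) contDiffOn_const (-1) (by norm_num) 0
  have h0 := congrArg (fun w : EuclideanSpace ℝ (Fin 3) => w 0) h1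
  simp at h0

/-! ## Clause (3) as typed: the null-set spike -/

/-- **LOAD-BEARING AS TYPED (the smoothness clause, through the pointwise conclusion).**
`PlaneEnergyCeiling.PlanarEnergyLiouville` with its joint-smoothness clause DROPPED (everything
else verbatim) is FALSE, by a null-set modification of the zero solution: the field equal to `e₀`
at the origin and `0` elsewhere (all times) is slice-wise a.e. zero — hence a bounded ancient mild
solution (`IsBoundedAncientMildSolution.congr_ae_slice`: every clause of the duality class is a
slice integral), with measurable slices and ALL planar energies `0` (a plane meets the origin in at
most one point, a null set of the plane) — but it is not pointwise zero. So the smoothness clause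
is what licenses the POINTWISE conclusion `∀ t < 0, ∀ x, v t x = 0`; the variant without
smoothness and with the a.e. conclusion `v t =ᵐ 0` is untouched by this witness (and is the
morally equivalent open statement: KNSS 2009 — bounded mild ancient solutions have a representative
smooth in `x`). [folklore] -/
theorem planarEnergyLiouville_false_without_smoothness :
    ¬ (∀ (v : ℝ → EuclideanSpace ℝ (Fin 3) → EuclideanSpace ℝ (Fin 3)),
        Literature.Analysis.FluidPDE.IsBoundedAncientMildSolution 1 v →
        (∀ t < 0, MeasureTheory.AEStronglyMeasurable (v t) MeasureTheory.volume) →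
        (∃ M : ℝ, ∀ t < 0, ∀ (R : EuclideanSpace ℝ (Fin 3) ≃ₗᵢ[ℝ] EuclideanSpace ℝ (Fin 3)) (c : ℝ),
          ∫⁻ y : EuclideanSpace ℝ (Fin 2), ‖v t (R (WithLp.toLp 2 ![y 0, y 1, c]))‖ₑ ^ 2
            ≤ ENNReal.ofReal M) →
        ∀ t < 0, ∀ x, v t x = 0) := by
  intro h
  -- the witness: `e₀` at the origin, `0` elsewhere
  set w : ℝ → EuclideanSpace ℝ (Fin 3) → EuclideanSpace ℝ (Fin 3) :=
    fun _ x => if x = 0 then EuclideanSpace.single 0 1 else 0 with hw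
  -- slice-wise a.e. equal to the zero field
  have hae : ∀ t : ℝ, w t =ᵐ[volume] fun _ => (0 : EuclideanSpace ℝ (Fin 3)) := by
    intro t
    have h0 : ({0}ᶜ : Set (EuclideanSpace ℝ (Fin 3))) ∈ ae (volume : Measure (EuclideanSpace ℝ (Fin 3))) :=
      compl_mem_ae_iff.2 (measure_singleton (0 : EuclideanSpace ℝ (Fin 3)))
    filter_upwards [h0] with x hx
    simp only [mem_compl_iff, mem_singleton_iff] at hx
    simp [hw, hx]
  -- bounded by 1
  have hwb : IsBoundedOn (Iio 0) w := by
    refine ⟨1, fun t _ x => ?_⟩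
    by_cases hx : x = 0
    · simp [hw, hx]
    · simp [hw, hx]
  -- hence a bounded ancient mild solution with measurable slices
  have hmild : IsBoundedAncientMildSolution 1 w :=
    (isBoundedAncientMildSolution_fun_const 1 (0 : EuclideanSpace ℝ (Fin 3))).congr_ae_slice
      (fun t _ => hae t) hwb
  have hmeas : ∀ t < 0, AEStronglyMeasurable (w t) (volume : Measure (EuclideanSpace ℝ (Fin 3))) :=
    fun t _ => (aestronglyMeasurable_const (b := (0 : EuclideanSpace ℝ (Fin 3)))).congr (hae t).symm
  -- every planar energy vanishes: the plane point `(y₀, y₁, c)` is the origin only at `y = 0`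
  have hplane : ∀ {y : EuclideanSpace ℝ (Fin 2)} {c : ℝ},
      (WithLp.toLp 2 ![y 0, y 1, c] : EuclideanSpace ℝ (Fin 3)) = 0 → y = 0 := by
    intro y c hyc
    have h0 := congrArg (fun z : EuclideanSpace ℝ (Fin 3) => z 0) hyc
    have h1 := congrArg (fun z : EuclideanSpace ℝ (Fin 3) => z 1) hyc
    simp at h0 h1
    ext i
    fin_cases i <;> simp [h0, h1]
  have hpl : ∃ M : ℝ, ∀ t < 0, ∀ (R : EuclideanSpace ℝ (Fin 3) ≃ₗᵢ[ℝ] EuclideanSpace ℝ (Fin 3)) (c : ℝ),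
      ∫⁻ y : EuclideanSpace ℝ (Fin 2), ‖w t (R (WithLp.toLp 2 ![y 0, y 1, c]))‖ₑ ^ 2
        ≤ ENNReal.ofReal M := by
    refine ⟨0, fun t _ R c => ?_⟩
    have h0 : ({0}ᶜ : Set (EuclideanSpace ℝ (Fin 2))) ∈ ae (volume : Measure (EuclideanSpace ℝ (Fin 2))) :=
      compl_mem_ae_iff.2 (measure_singleton (0 : EuclideanSpace ℝ (Fin 2)))
    have hzero : (fun y : EuclideanSpace ℝ (Fin 2) => ‖w t (R (WithLp.toLp 2 ![y 0, y 1, c]))‖ₑ ^ 2)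
        =ᵐ[volume] fun _ => 0 := by
      filter_upwards [h0] with y hy
      simp only [mem_compl_iff, mem_singleton_iff] at hy
      have hne : R (WithLp.toLp 2 ![y 0, y 1, c]) ≠ 0 := by
        intro hR
        have hp : (WithLp.toLp 2 ![y 0, y 1, c] : EuclideanSpace ℝ (Fin 3)) = 0 := by
          simpa using congrArg R.symm hR
        exact hy (hplane hp)
      simp [hw, hne]
    rw [lintegral_congr_ae hzero, lintegral_zero]
    exact zero_le
  -- but the field is `e₀ ≠ 0` at the origin at `t = -1`
  have h1 := h w hmild hmeas hpl (-1) (by norm_num) 0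
  have h10 := congrArg (fun z : EuclideanSpace ℝ (Fin 3) => z 0) h1
  simp [hw] at h10

end Summit.NavierStokesRegularity.NavierStokesRegularity.Theorems.PlanarEnergyLiouvilleNegative

end
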